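import Summits.HubbardSuperconductivity.HubbardSuperconductivity.Theorems.MesoscopicPairOrder.Negative.Ceiling
import Summits.HubbardSuperconductivity.HubbardSuperconductivity.Theorems.FunctionFieldCertificateMesoscopicPairOrderStubBoxExpectation
import Literature.MathematicalPhysics.QuantumLattice.PairChirality
import Literature.MathematicalPhysics.QuantumLattice.HubbardWave0RepulsiveProofs
import Literature.MathematicalPhysics.QuantumLattice.HubbardWave0PosSemidefProofs
import Literature.MathematicalPhysics.QuantumLattice.PairCorrelationsProofs
import Literature.MathematicalPhysics.QuantumLattice.PairFieldCarrierBound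
import HarnessLib

/-!
# Crux `MesoscopicPairOrder` (item `stmt-HubbardSuperconductivity-7331`): the POLARISED ceiling, I —
# `su(2)` ladder transfer and locality of the local pair weight

Negative-side support (lead c8, line `pointwise_split`), file 1 of 2 (file 2: `PolarisedCeiling.lean`). The disprover's exclusion
(`Negative/SaturatedExclusion.pointwise_false_of_saturated`) uses that every local singlet pair `P_x`
KILLS a saturated ferromagnet (`S = n` for `2n` particles), so `T_R = 0` there; its workfile (§4 (iii))
records that the quantitative version via the all-pairs singlet SUM RULE is vacuous already at spin
deficiency `n - S = 1`, and that "a useful version needs LOCALITY of the spin deficiency". This file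
proves the local version:

* §1 `su2_re_form_P_pow_eq` — abstract ladder transfer: for an `su(2)` triple `(P, M, Z)`, an
  operator `K` commuting with `M`, and a weight-`0` vector `ψ₀` with Casimir `J(J+1)`, the top member
  `φ = P^J ψ₀` has `⟨φ, K φ⟩ = c ⟨ψ₀, K ψ₀⟩` and `⟨φ, φ⟩ = c ⟨ψ₀, ψ₀⟩` with the SAME `c > 0`.
* §2 `sum_re_localPair_le_down` — LOCALITY: for any vector `φ` of Lieb's sector `(a, b)` (i.e. `b` down
  electrons), `Σ_x ‖P_x φ‖² ≤ 4 κ_g |E| · b · ‖φ‖²`, because every term of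
  `P_x = Σ_{e ∈ E} (g e/√2)(c_{x↑}c_{x+e,↓} - c_{x↓}c_{x+e,↑})` contains one DOWN annihilator
  (`‖c_{x↑} c_{y↓} φ‖ ≤ ‖c_{y↓} φ‖`, `Σ_y ‖c_{y↓} φ‖² = b ‖φ‖²`); here `E = {0} ∪ unitSteps`,
  `κ_g = Σ_{e ∈ E} |g e/√2|²`.
* §3 (file 2, `boxSum_le_sq_mul_spinDeficiency`) — for a vector `ψ` of the `S^z = 0` sector `(n, n)`
  with `S² ψ = S(S+1) ψ`: `T_R(ψ) ≤ 4 κ_g |E| · R² (n - S) · ‖ψ‖² ≤ 100 R² (n - S) ‖ψ‖²`.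

So the crux margin at `(U, δ)` forces an EXTENSIVE spin deficiency `n - S ≥ m L²/(4 κ_g |E|)` in every
`S²`-diagonal sector ground state (companion file `PolarisedExclusion.lean`: ground states with
`n - S = o(L²)` along infinitely many even sides — saturated OR NEARLY saturated ferromagnets — refute the
crux body and stub (B) at that point). Sources: H. Tasaki, Prog. Theor. Phys. 99 (1998) 489, p. 20
(singlet pairs vs. ferromagnets); H. Tasaki, *Physics and Mathematics of Quantum Many-Body Systems*
(2020) §2.4, App. A.3 (`su(2)` ladders); E. H. Lieb, PRL 62 (1989) 1201 (sectors). No definition,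
no named fact, no sorry.
-/

noncomputable section

-- the summit namespace repeats the problem name by design (D-0017)
set_option linter.dupNamespace false

/-! ### §1 Abstract `su(2)` ladder transfer -/

namespace Summit.HubbardSuperconductivity.HubbardSuperconductivity.Theorems.MesoscopicPairOrder.Negative

open Matrix Literature.MathematicalPhysics.QuantumLattice
open scoped ComplexOrder

section Ladder

variable {ι : Type*} [Fintype ι] [DecidableEq ι] {P M Z : Matrix ι ι ℂ}

/-- The ladder product `Π_{i<J} (J(J+1) - i² - i)` is the natural number `Π_{i<J} (J - i)(J + i + 1)`. [folklore] -/
theorem ladderProd_eq_natCast (J : ℕ) :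
    (∏ i ∈ Finset.range J, (((J : ℂ) * (J + 1)) - i * i - i)) =
      ((∏ i ∈ Finset.range J, ((J - i) * (J + i + 1)) : ℕ) : ℂ) := by
  rw [Nat.cast_prod]
  refine Finset.prod_congr rfl fun i hi => ?_
  rw [Finset.mem_range] at hi
  rw [Nat.cast_mul, Nat.cast_sub hi.le]
  push_cast
  ring

/-- The ladder product is a positive natural number. [folklore] -/
theorem ladderProd_pos (J : ℕ) : 0 < ∏ i ∈ Finset.range J, ((J - i) * (J + i + 1)) :=
  Finset.prod_pos fun i hi => by
    rw [Finset.mem_range] at hi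
    exact Nat.mul_pos (by omega) (by omega)

/-- **Ladder transfer of a quadratic form.** Let `(P, M, Z)` be an `su(2)` triple, `K` an operator
commuting with the lowering operator `M`, and `ψ₀` a weight-`0` vector (`Z ψ₀ = 0`) with Casimir
eigenvalue `J(J+1)`. Then the top member `P^J ψ₀` of its ladder has
`⟨P^J ψ₀, K P^J ψ₀⟩ = c · ⟨ψ₀, K ψ₀⟩` with `c = Π_{i<J} (J - i)(J + i + 1)`
(`(P^J)ᴴ = M^J`, `M^J K = K M^J`, `M^J P^J ψ₀ = c ψ₀` by `M_pow_P_pow`). Tasaki (2020) §2.4. [folklore] -/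
theorem su2_form_P_pow_eq (h : IsSu2Triple P M Z) (K : Matrix ι ι ℂ) (hK : Commute K M) {ψ₀ : ι → ℂ}
    (hZ0 : Z *ᵥ ψ₀ = 0) (J : ℕ) (hC : su2Casimir P M Z *ᵥ ψ₀ = ((J : ℂ) * (J + 1)) • ψ₀) :
    star (P ^ J *ᵥ ψ₀) ⬝ᵥ (K *ᵥ (P ^ J *ᵥ ψ₀)) =
      ((∏ i ∈ Finset.range J, ((J - i) * (J + i + 1)) : ℕ) : ℂ) * (star ψ₀ ⬝ᵥ (K *ᵥ ψ₀)) := by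
  have hadj : (P ^ J)ᴴ = M ^ J := by rw [conjTranspose_pow, ← h.adj]
  rw [star_mulVec, ← dotProduct_mulVec, hadj, mulVec_mulVec, ← (hK.pow_right J).eq, ← mulVec_mulVec,
    h.M_pow_P_pow hZ0 hC J, mulVec_smul, dotProduct_smul, smul_eq_mul, ladderProd_eq_natCast]

/-- Real-part form of `su2_form_P_pow_eq`. [folklore] -/
theorem su2_re_form_P_pow_eq (h : IsSu2Triple P M Z) (K : Matrix ι ι ℂ) (hK : Commute K M) {ψ₀ : ι → ℂ}
    (hZ0 : Z *ᵥ ψ₀ = 0) (J : ℕ) (hC : su2Casimir P M Z *ᵥ ψ₀ = ((J : ℂ) * (J + 1)) • ψ₀) :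
    (star (P ^ J *ᵥ ψ₀) ⬝ᵥ (K *ᵥ (P ^ J *ᵥ ψ₀))).re =
      ((∏ i ∈ Finset.range J, ((J - i) * (J + i + 1)) : ℕ) : ℝ) * (star ψ₀ ⬝ᵥ (K *ᵥ ψ₀)).re := by
  rw [su2_form_P_pow_eq h K hK hZ0 J hC, ← Complex.ofReal_natCast, Complex.re_ofReal_mul]

/-- The norm of the top member: `⟨P^J ψ₀, P^J ψ₀⟩ = c · ⟨ψ₀, ψ₀⟩` with the same `c`. [folklore] -/
theorem su2_re_normSq_P_pow_eq (h : IsSu2Triple P M Z) {ψ₀ : ι → ℂ} (hZ0 : Z *ᵥ ψ₀ = 0) (J : ℕ)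
    (hC : su2Casimir P M Z *ᵥ ψ₀ = ((J : ℂ) * (J + 1)) • ψ₀) :
    (star (P ^ J *ᵥ ψ₀) ⬝ᵥ (P ^ J *ᵥ ψ₀)).re =
      ((∏ i ∈ Finset.range J, ((J - i) * (J + i + 1)) : ℕ) : ℝ) * (star ψ₀ ⬝ᵥ ψ₀).re := by
  have h1 := su2_re_form_P_pow_eq h 1 (Commute.one_left M) hZ0 J hC
  rwa [one_mulVec, one_mulVec] at h1

end Ladder

end Summit.HubbardSuperconductivity.HubbardSuperconductivity.Theorems.MesoscopicPairOrder.Negative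


/-! ### §2 Locality: the local pair weight is bounded by the number of down electrons -/

namespace Summit.HubbardSuperconductivity.HubbardSuperconductivity.Theorems.MesoscopicPairOrder.Negative

open Matrix Finset Filter
open Literature.Probability.LatticeModels Literature.MathematicalPhysics.QuantumLattice
open scoped ComplexOrder ComplexConjugate

section Locality

variable {L : ℕ} [NeZero L]

/-- `Σ_x ‖c_{x↓} φ‖² = b ‖φ‖²` on Lieb's sector `(a, b)` (the down number is `b`). Lieb, PRL 62 (1989) 1201,
eq. (2). [folklore] -/
theorem sum_re_star_annihilation_down_eq {a b : ℕ} {φ : Fock (Orb (FermionTorus 2 L))}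
    (hφ : IsInSector a b φ) :
    ∑ x : TorusSite 2 L,
        (star (annihilation (orb (FermionTorus.ofTorusSite x) 1) *ᵥ φ) ⬝ᵥ
          (annihilation (orb (FermionTorus.ofTorusSite x) 1) *ᵥ φ)).re =
      (b : ℝ) * (star φ ⬝ᵥ φ).re := by
  -- the complex identity over the fermionic torus (`convert` bridges the `Decidable` instances of
  -- the library lemma and of `downPart`)
  have key' : ∀ tt : Finset (Orb (FermionTorus 2 L)),
      (∑ x : FermionTorus 2 L, if orb x 1 ∈ tt then star (φ tt) * φ tt else 0) =
        ((downPart tt).card : ℂ) * (star (φ tt) * φ tt) := by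
    intro tt
    rw [Finset.sum_ite, Finset.sum_const_zero, add_zero, Finset.sum_const, nsmul_eq_mul]
    unfold downPart
    congr!
  have key : ∑ y : FermionTorus 2 L,
      star (annihilation (orb y 1) *ᵥ φ) ⬝ᵥ (annihilation (orb y 1) *ᵥ φ) = (b : ℂ) * (star φ ⬝ᵥ φ) := by
    simp_rw [PosSemidefTrace.star_annihilation_mulVec_dotProduct]
    rw [Finset.sum_comm, dotProduct, Finset.mul_sum]
    refine Finset.sum_congr rfl fun t _ => ?_
    rw [Pi.star_apply]
    by_cases ht : (upPart t).card = a ∧ (downPart t).card = b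
    · rw [← ht.2]
      convert key' t using 3
    · rw [hφ t ht]
      simp
  -- reindex the torus sites by the fermionic torus and take real parts
  have hre : ∑ x : TorusSite 2 L,
      (star (annihilation (orb (FermionTorus.ofTorusSite x) 1) *ᵥ φ) ⬝ᵥ
        (annihilation (orb (FermionTorus.ofTorusSite x) 1) *ᵥ φ)).re =
      ∑ y : FermionTorus 2 L,
        (star (annihilation (orb y 1) *ᵥ φ) ⬝ᵥ (annihilation (orb y 1) *ᵥ φ)).re := by
    rw [← (FermionTorus.equivTorusSite (d := 2) (L := L)).symm.sum_comp]
    rfl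
  rw [hre, ← Complex.re_sum, key, ← Complex.ofReal_natCast, Complex.re_ofReal_mul]

omit [NeZero L] in
/-- One term of `P_x φ` is controlled by a down annihilator:
`‖c_{x↑} c_{y↓} φ - c_{x↓} c_{z↑} φ‖ ≤ ‖c_{y↓} φ‖ + ‖c_{x↓} φ‖` (`c_{x↓} c_{z↑} = -c_{z↑} c_{x↓}`, annihilators
are contractions). Bratteli–Robinson II §5.2.2. [folklore] -/
theorem norm_pairTerm_le (i j k l : Orb (FermionTorus 2 L)) (φ : Fock (Orb (FermionTorus 2 L))) :
    ‖(WithLp.toLp 2 (annihilation i *ᵥ (annihilation j *ᵥ φ) - annihilation k *ᵥ (annihilation l *ᵥ φ)) :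
        EuclideanSpace ℂ (Finset (Orb (FermionTorus 2 L))))‖ ≤
      ‖(WithLp.toLp 2 (annihilation j *ᵥ φ) : EuclideanSpace ℂ (Finset (Orb (FermionTorus 2 L))))‖ +
        ‖(WithLp.toLp 2 (annihilation k *ᵥ φ) : EuclideanSpace ℂ (Finset (Orb (FermionTorus 2 L))))‖ := by
  have hanti : annihilation k *ᵥ (annihilation l *ᵥ φ) = -(annihilation l *ᵥ (annihilation k *ᵥ φ)) := by
    rw [mulVec_mulVec, mulVec_mulVec, LiebThm1.annihilation_mul_annihilation_eq_neg k l, neg_mulVec]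
  rw [hanti, sub_neg_eq_add, WithLp.toLp_add]
  refine (norm_add_le _ _).trans (add_le_add ?_ ?_)
  · exact norm_toLp_annihilation_mulVec_le _ _
  · exact norm_toLp_annihilation_mulVec_le _ _

/-- **LOCALITY: the local `d`-wave (or any `g`) pair weight is controlled by the down electrons.** For a
vector `φ` of Lieb's sector `(a, b)` of the `L × L` torus,
`Σ_x ‖P_x φ‖² ≤ 4 κ_g |E| · b · ‖φ‖²`, `E = {0} ∪ unitSteps`, `κ_g = Σ_{e ∈ E} |g e/√2|²`:
`‖P_x φ‖ ≤ Σ_e |g e/√2| (‖c_{x+e,↓} φ‖ + ‖c_{x↓} φ‖)` (`localPair_mulVec_eq_sum`, `norm_pairTerm_le`),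
Cauchy–Schwarz over `e`, `(u + v)² ≤ 2u² + 2v²`, and `Σ_x ‖c_{x+e,↓} φ‖² = Σ_x ‖c_{x↓} φ‖² = b ‖φ‖²`
(`sum_re_star_annihilation_down_eq`). Tasaki, Prog. Theor. Phys. 99 (1998) 489, p. 20 (every singlet pair
needs a down electron). [folklore] -/
theorem sum_re_localPair_le_down (g : Site 2 → ℝ) {a b : ℕ} {φ : Fock (Orb (FermionTorus 2 L))}
    (hφ : IsInSector a b φ) :
    ∑ x : TorusSite 2 L, (star (localPair g L x *ᵥ φ) ⬝ᵥ (localPair g L x *ᵥ φ)).re ≤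
      4 * (∑ e ∈ insert 0 unitSteps, ‖((g e / Real.sqrt 2 : ℝ) : ℂ)‖ ^ 2) *
        ((insert (0 : Site 2) unitSteps).card : ℝ) * (b : ℝ) * (star φ ⬝ᵥ φ).re := by
  set E : Finset (Site 2) := insert 0 unitSteps with hE
  set κ : ℝ := ∑ e ∈ E, ‖((g e / Real.sqrt 2 : ℝ) : ℂ)‖ ^ 2 with hκ
  -- norms of the down-annihilated vectors
  set A : TorusSite 2 L → Site 2 → ℝ := fun x e =>
    ‖(WithLp.toLp 2 (annihilation (orb (FermionTorus.ofTorusSite (x + Torus.proj L e)) 1) *ᵥ φ) :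
      EuclideanSpace ℂ (Finset (Orb (FermionTorus 2 L))))‖ with hA
  set B : TorusSite 2 L → ℝ := fun x =>
    ‖(WithLp.toLp 2 (annihilation (orb (FermionTorus.ofTorusSite x) 1) *ᵥ φ) :
      EuclideanSpace ℂ (Finset (Orb (FermionTorus 2 L))))‖ with hB
  have hκ0 : 0 ≤ κ := Finset.sum_nonneg fun _ _ => by positivity
  -- pointwise: `‖P_x φ‖ ≤ Σ_e |c_e| (A x e + B x)`
  have hpt : ∀ x : TorusSite 2 L,
      ‖(WithLp.toLp 2 (localPair g L x *ᵥ φ) : EuclideanSpace ℂ (Finset (Orb (FermionTorus 2 L))))‖ ≤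
        ∑ e ∈ E, ‖((g e / Real.sqrt 2 : ℝ) : ℂ)‖ * (A x e + B x) := by
    intro x
    have hexp : localPair g L x *ᵥ φ =
        ∑ e ∈ E, ((g e / Real.sqrt 2 : ℝ) : ℂ) •
          (annihilation (orb (FermionTorus.ofTorusSite x) 0) *ᵥ
              (annihilation (orb (FermionTorus.ofTorusSite (x + Torus.proj L e)) 1) *ᵥ φ) -
            annihilation (orb (FermionTorus.ofTorusSite x) 1) *ᵥ
              (annihilation (orb (FermionTorus.ofTorusSite (x + Torus.proj L e)) 0) *ᵥ φ)) := by
      simp only [localPair, hE, Matrix.sum_mulVec, Matrix.smul_mulVec, Matrix.sub_mulVec,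
        ← Matrix.mulVec_mulVec]
    rw [hexp, WithLp.toLp_sum]
    refine (norm_sum_le _ _).trans (Finset.sum_le_sum fun e _ => ?_)
    rw [WithLp.toLp_smul, norm_smul]
    exact mul_le_mul_of_nonneg_left (norm_pairTerm_le _ _ _ _ φ) (norm_nonneg _)
  -- squared, by Cauchy–Schwarz over `e` and `(u+v)² ≤ 2u² + 2v²`
  have hsq : ∀ x : TorusSite 2 L,
      (star (localPair g L x *ᵥ φ) ⬝ᵥ (localPair g L x *ᵥ φ)).re ≤
        κ * ∑ e ∈ E, 2 * (A x e ^ 2 + B x ^ 2) := by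
    intro x
    rw [← norm_toLp_sq_eq_re]
    have h1 := hpt x
    have h0 : 0 ≤ ∑ e ∈ E, ‖((g e / Real.sqrt 2 : ℝ) : ℂ)‖ * (A x e + B x) :=
      Finset.sum_nonneg fun e _ => mul_nonneg (norm_nonneg _) (add_nonneg (norm_nonneg _) (norm_nonneg _))
    calc ‖(WithLp.toLp 2 (localPair g L x *ᵥ φ) : EuclideanSpace ℂ (Finset (Orb (FermionTorus 2 L))))‖ ^ 2
        ≤ (∑ e ∈ E, ‖((g e / Real.sqrt 2 : ℝ) : ℂ)‖ * (A x e + B x)) ^ 2 :=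
          pow_le_pow_left₀ (norm_nonneg _) h1 2
      _ ≤ (∑ e ∈ E, ‖((g e / Real.sqrt 2 : ℝ) : ℂ)‖ ^ 2) * ∑ e ∈ E, (A x e + B x) ^ 2 :=
          Finset.sum_mul_sq_le_sq_mul_sq _ _ _
      _ ≤ κ * ∑ e ∈ E, 2 * (A x e ^ 2 + B x ^ 2) := by
          refine mul_le_mul_of_nonneg_left (Finset.sum_le_sum fun e _ => ?_) hκ0
          nlinarith [sq_nonneg (A x e - B x)]
  -- the two down-number sums
  have hAsum : ∀ e : Site 2, ∑ x : TorusSite 2 L, A x e ^ 2 = (b : ℝ) * (star φ ⬝ᵥ φ).re := by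
    intro e
    simp only [hA, norm_toLp_sq_eq_re]
    rw [← sum_re_star_annihilation_down_eq (L := L) hφ]
    exact Fintype.sum_equiv (Equiv.addRight (Torus.proj L e)) _ _ fun x => rfl
  have hBsum : ∑ x : TorusSite 2 L, B x ^ 2 = (b : ℝ) * (star φ ⬝ᵥ φ).re := by
    simp only [hB, norm_toLp_sq_eq_re]
    exact sum_re_star_annihilation_down_eq (L := L) hφ
  -- assemble
  calc ∑ x : TorusSite 2 L, (star (localPair g L x *ᵥ φ) ⬝ᵥ (localPair g L x *ᵥ φ)).re
      ≤ ∑ x : TorusSite 2 L, κ * ∑ e ∈ E, 2 * (A x e ^ 2 + B x ^ 2) := Finset.sum_le_sum fun x _ => hsq x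
    _ = κ * (2 * ∑ e ∈ E, (∑ x : TorusSite 2 L, A x e ^ 2 + ∑ x : TorusSite 2 L, B x ^ 2)) := by
        rw [← Finset.mul_sum, Finset.sum_comm]
        congr 1
        rw [Finset.mul_sum]
        refine Finset.sum_congr rfl fun e _ => ?_
        rw [← Finset.mul_sum, Finset.sum_add_distrib]
    _ = κ * (2 * ∑ e ∈ E, (2 * ((b : ℝ) * (star φ ⬝ᵥ φ).re))) := by
        congr 2
        refine Finset.sum_congr rfl fun e _ => ?_
        rw [hAsum e, hBsum]; ring
    _ = 4 * κ * (E.card : ℝ) * (b : ℝ) * (star φ ⬝ᵥ φ).re := by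
        rw [Finset.sum_const, nsmul_eq_mul]; ring

/-- **Registered form** (`sumReLocalPairLeDown`, sub-goal of stmt-7331): locality of the local pair weight,
one-line verbatim signature. [folklore] -/
theorem sumReLocalPairLeDown : ∀ {L : ℕ} [NeZero L] (g : Site 2 → ℝ) {a b : ℕ} {φ : Fock (Orb (FermionTorus 2 L))}, IsInSector a b φ → ∑ x : TorusSite 2 L, (star (localPair g L x *ᵥ φ) ⬝ᵥ (localPair g L x *ᵥ φ)).re ≤ 4 * (∑ e ∈ insert 0 unitSteps, ‖((g e / Real.sqrt 2 : ℝ) : ℂ)‖ ^ 2) * ((insert (0 : Site 2) unitSteps).card : ℝ) * (b : ℝ) * (star φ ⬝ᵥ φ).re :=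
  fun g _ _ _ hφ => sum_re_localPair_le_down g hφ

end Locality

end Summit.HubbardSuperconductivity.HubbardSuperconductivity.Theorems.MesoscopicPairOrder.Negative
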